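import Literature.Computability.Complexity.GraphCanonization
import Literature.Computability.Complexity.GraphCanonizationLeader
import Literature.Computability.Complexity.LeaderFoldBricks
import Literature.Computability.Complexity.IndividualizationRefinement
import Literature.Computability.Complexity.ExpTimeMaps
import Literature.Computability.Complexity.IsqrtBrick
import Literature.Computability.Complexity.FPStringBricks
import HarnessLib

/-!
# Canonical forms in time `2^{O(√N)}`: the padding reduction (toward Babai–Luks 1983)

First, canoniser-independent step of the discharge of the named fact `babaiLuks1983_canonicalForm`
(`GraphCanonization.lean`: canonical forms of vertex-coloured graphs in time `2^{O(√N)}`, `N` the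
code length; Babai–Luks, STOC 1983, §1 and §4). The tree programs string functions in the
polynomial-time brick algebra (`BrickAlgebra.lean`, `StackBricks*.lean`), which only speaks `FP`;
a moderately exponential algorithm is therefore run on a PADDED input, as in the `E`/`EXP`
bookkeeping of `ExpTimeMaps.lean` (`lpad`), here with the root-exponential pad
`spad a x = ⟨1^{2^{a⌊√|x|⌋}} 0 1^{a⌊√|x|⌋}, x⟩ = mapFstFn (expPad 1 ∘ sqrtOnesFn a) ∘ copyFn`
(integer square root by the brick `Brick.isqrtFn`, `IsqrtBrick.lean`).

* `IsSqrtExpBounded f` (`f n ≤ 2^{c⌊√n⌋ + c}`): closed under `+`, `·`, powers, polynomials of it,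
  and linearly bounded substitutions (`⌊√(a n + a)⌋ ≤ a⌊√n⌋ + a`); contains the polynomials
  (`n + 1 ≤ 2^{2⌊√n⌋ + 2}`).
* `FEsqrt = ⋃_c FTIME(2^{c⌊√n⌋})` (the time bound of the fact): `FP ⊆ FEsqrt`; `g ∘ f`, `f ∘ g ∈ FEsqrt`
  for `f ∈ FP` (linear output in the first case) and `g ∈ FEsqrt`; `mapFstFn g ∈ FEsqrt` — by
  `TimeComputable.comp_holds` and the machine `mapFstAux` (`outputsWithin_mapFstAux`).
* **`spad a ∈ FEsqrt`**, **`f ∘ spad a ∈ FEsqrt` for `f ∈ FP`** (`comp_spad_mem_FEsqrt`); on the code of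
  a coloured graph on `k` vertices the pad has length `≥ 2^{a⌊√N⌋} ≥ 2^{a k}` (`N ≥ k²`,
  `two_pow_mul_le_length_spad_colGraphCode`), and the code is its second component.
* **The reduction** `babaiLuks1983_canonicalForm_of_core`: an `FP` map `f` with `f ∘ spad a` a
  canonical form on codes of coloured graphs proves `babaiLuks1983_canonicalForm`
  (`babaiLuks1983_canonicalForm_of_mem_FEsqrt`: so does any canonical form in `FEsqrt`); combined
  with the machine-free correctness skeleton of `GraphCanonizationLeader.lean`
  (`leader_isCanonicalForm`): **`babaiLuks1983_canonicalForm_of_leader`** — an `FP` map computing on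
  padded codes the lexicographic leader over a nonempty, equivariant set of labelings proves the fact;
  and, with the search trees of `IndividualizationRefinement.lean` and the leader fold of
  `LeaderFoldBricks.lean`: **`babaiLuks1983_canonicalForm_of_irScheme`** — an `FP` map LISTING, on
  padded codes, the leaf labelings of any individualization–refinement scheme proves the fact.

Not here (what remains for `babaiLuks1983_canonicalForm_holds`): an `FP` brick computing, on
`⟨pad, colGraphCode k G col⟩` with `|pad| ≥ 2^{a k}`, the code of a canonical representative of the
colour-isomorphism class, i.e. a simply-exponential (`C^k · poly`) canoniser programmed and
verified in the brick algebra (Babai–Luks §1 credit a combinatorial `cⁿ` canonisation to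
Corneil–Goldberg; brute force over the `k!` relabellings does not fit, `k! ≠ 2^{O(k)}`).

## References

* L. Babai, E. M. Luks, *Canonical labeling of graphs*, STOC 1983, 171–183,
  doi:10.1145/800061.808746, §1, §4. [BabaiLuks1983]
* S. Arora, B. Barak, *Computational Complexity: A Modern Approach*, CUP 2009, §1.3 (Claim 1.6:
  running times compose), §2.6 (padding). [AroraBarakCC2009]
-/

namespace Literature.Computability.Complexity

open _root_.Computability Turing Polynomial AlgebraicComplexity

/-! ### Root-exponentially bounded functions `f n ≤ 2^{c⌊√n⌋ + c}` -/

/-- `f : ℕ → ℕ` is *root-exponentially bounded* (`2^{O(√n)}`): `f n ≤ 2 ^ (c ⌊√n⌋ + c)` for all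
`n`, for some constant `c`. [folklore] -/
def IsSqrtExpBounded (f : ℕ → ℕ) : Prop := ∃ c : ℕ, ∀ n, f n ≤ 2 ^ (c * Nat.sqrt n + c)

namespace IsSqrtExpBounded

/-- A function below a root-exponentially bounded one is root-exponentially bounded. [folklore] -/
theorem mono {f g : ℕ → ℕ} (hg : IsSqrtExpBounded g) (h : ∀ n, f n ≤ g n) : IsSqrtExpBounded f := by
  obtain ⟨c, hc⟩ := hg
  exact ⟨c, fun n => (h n).trans (hc n)⟩

/-- Constants are root-exponentially bounded. [folklore] -/
theorem const (C : ℕ) : IsSqrtExpBounded fun _ => C :=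
  ⟨C, fun _ => (Nat.lt_two_pow_self).le.trans (Nat.pow_le_pow_right Nat.two_pos (Nat.le_add_left _ _))⟩

/-- `2 ^ (a ⌊√n⌋)` is root-exponentially bounded. [folklore] -/
theorem two_pow_mul_sqrt (a : ℕ) : IsSqrtExpBounded fun n => 2 ^ (a * Nat.sqrt n) :=
  ⟨a, fun _ => Nat.pow_le_pow_right Nat.two_pos (Nat.le_add_right _ _)⟩

/-- `n + 1 ≤ 2 ^ (2 ⌊√n⌋ + 2)` (as `n < (⌊√n⌋ + 1)²` and `m ≤ 2 ^ m`). [folklore] -/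
theorem succ_le_two_pow_sqrt (n : ℕ) : n + 1 ≤ 2 ^ (2 * Nat.sqrt n + 2) := by
  have h1 : n + 1 ≤ (Nat.sqrt n + 1) * (Nat.sqrt n + 1) := Nat.succ_le_of_lt (Nat.lt_succ_sqrt n)
  have h2 : Nat.sqrt n + 1 ≤ 2 ^ (Nat.sqrt n + 1) := (Nat.lt_two_pow_self).le
  calc n + 1 ≤ (Nat.sqrt n + 1) * (Nat.sqrt n + 1) := h1
    _ ≤ 2 ^ (Nat.sqrt n + 1) * 2 ^ (Nat.sqrt n + 1) := Nat.mul_le_mul h2 h2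
    _ = 2 ^ (2 * Nat.sqrt n + 2) := by rw [← pow_add]; ring_nf

/-- p-bounded functions are root-exponentially bounded (`poly(n) ≤ poly(2^{2√n+2})`). [folklore] -/
theorem of_isPBounded {f : ℕ → ℕ} (hf : IsPBounded f) : IsSqrtExpBounded f := by
  obtain ⟨C, c, hC⟩ := (IsPBounded.iff_exists_le_mul_succ_pow f).1 hf
  refine ⟨C + 2 * c, fun n => ?_⟩
  have h2 : C ≤ 2 ^ C := (Nat.lt_two_pow_self).le
  calc f n ≤ C * (n + 1) ^ c := hC n
    _ ≤ 2 ^ C * (2 ^ (2 * Nat.sqrt n + 2)) ^ c :=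
        Nat.mul_le_mul h2 (Nat.pow_le_pow_left (succ_le_two_pow_sqrt n) c)
    _ = 2 ^ (C + (2 * Nat.sqrt n + 2) * c) := by rw [← pow_mul, ← pow_add]
    _ ≤ 2 ^ ((C + 2 * c) * Nat.sqrt n + (C + 2 * c)) :=
        Nat.pow_le_pow_right Nat.two_pos (by nlinarith)

/-- Polynomials are root-exponentially bounded. [folklore] -/
theorem poly (p : Polynomial ℕ) : IsSqrtExpBounded fun n => p.eval n :=
  of_isPBounded ((isPBounded_iff_exists_polynomial_holds _).2 ⟨p, fun _ => le_rfl⟩)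

/-- The identity is root-exponentially bounded. [folklore] -/
theorem id : IsSqrtExpBounded fun n => n := (poly X).mono fun n => by simp

/-- Sums. [folklore] -/
theorem add {f g : ℕ → ℕ} (hf : IsSqrtExpBounded f) (hg : IsSqrtExpBounded g) :
    IsSqrtExpBounded fun n => f n + g n := by
  obtain ⟨a, ha⟩ := hf
  obtain ⟨b, hb⟩ := hg
  refine ⟨a + b + 1, fun n => ?_⟩
  have h1 : 2 ^ (a * Nat.sqrt n + a) ≤ 2 ^ ((a + b) * Nat.sqrt n + (a + b)) :=
    Nat.pow_le_pow_right (by norm_num) (by nlinarith)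
  have h2 : 2 ^ (b * Nat.sqrt n + b) ≤ 2 ^ ((a + b) * Nat.sqrt n + (a + b)) :=
    Nat.pow_le_pow_right (by norm_num) (by nlinarith)
  calc f n + g n ≤ 2 ^ ((a + b) * Nat.sqrt n + (a + b)) + 2 ^ ((a + b) * Nat.sqrt n + (a + b)) :=
        Nat.add_le_add ((ha n).trans h1) ((hb n).trans h2)
    _ = 2 ^ ((a + b) * Nat.sqrt n + (a + b) + 1) := by rw [pow_succ]; ring
    _ ≤ 2 ^ ((a + b + 1) * Nat.sqrt n + (a + b + 1)) :=
        Nat.pow_le_pow_right (by norm_num) (by nlinarith)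

/-- Products. [folklore] -/
theorem mul {f g : ℕ → ℕ} (hf : IsSqrtExpBounded f) (hg : IsSqrtExpBounded g) :
    IsSqrtExpBounded fun n => f n * g n := by
  obtain ⟨a, ha⟩ := hf
  obtain ⟨b, hb⟩ := hg
  refine ⟨a + b, fun n => ?_⟩
  calc f n * g n ≤ 2 ^ (a * Nat.sqrt n + a) * 2 ^ (b * Nat.sqrt n + b) := Nat.mul_le_mul (ha n) (hb n)
    _ = 2 ^ ((a + b) * Nat.sqrt n + (a + b)) := by rw [← pow_add]; ring_nf

/-- Constant multiples. [folklore] -/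
theorem const_mul {f : ℕ → ℕ} (hf : IsSqrtExpBounded f) (a : ℕ) : IsSqrtExpBounded fun n => a * f n :=
  (const a).mul hf

/-- Powers. [folklore] -/
theorem pow {f : ℕ → ℕ} (hf : IsSqrtExpBounded f) (e : ℕ) : IsSqrtExpBounded fun n => f n ^ e := by
  obtain ⟨a, ha⟩ := hf
  refine ⟨a * e, fun n => ?_⟩
  calc f n ^ e ≤ (2 ^ (a * Nat.sqrt n + a)) ^ e := Nat.pow_le_pow_left (ha n) e
    _ = 2 ^ (a * e * Nat.sqrt n + a * e) := by rw [← pow_mul]; ring_nf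

/-- A p-bounded function of a root-exponentially bounded one is root-exponentially bounded
(`poly(2^{O(√n)}) = 2^{O(√n)}`). [folklore] -/
theorem isPBounded_comp {f g : ℕ → ℕ} (hf : IsPBounded f) (hg : IsSqrtExpBounded g) :
    IsSqrtExpBounded fun n => f (g n) := by
  obtain ⟨C, c, hC⟩ := (IsPBounded.iff_exists_le_mul_succ_pow f).1 hf
  have h1 : IsSqrtExpBounded fun n => g n + 1 := hg.add (const 1)
  have h2 : IsSqrtExpBounded fun n => C * (g n + 1) ^ c := (const C).mul (h1.pow c)
  exact h2.mono fun n => hC (g n)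

/-- Post-composition with a polynomial. [folklore] -/
theorem poly_comp {g : ℕ → ℕ} (p : Polynomial ℕ) (hg : IsSqrtExpBounded g) :
    IsSqrtExpBounded fun n => p.eval (g n) :=
  isPBounded_comp ((isPBounded_iff_exists_polynomial_holds _).2 ⟨p, fun _ => le_rfl⟩) hg

/-- `⌊√(s n)⌋ ≤ a ⌊√n⌋ + a` whenever `s n ≤ a n + a` (as `a n + a ≤ a (⌊√n⌋ + 1)² ≤ (a ⌊√n⌋ + a)²`).
[folklore] -/
theorem sqrt_le_of_linear {s : ℕ → ℕ} {a : ℕ} (hs : ∀ n, s n ≤ a * n + a) (n : ℕ) :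
    Nat.sqrt (s n) ≤ a * Nat.sqrt n + a := by
  set r := Nat.sqrt n with hr
  have hn : n + 1 ≤ (r + 1) * (r + 1) := Nat.succ_le_of_lt (Nat.lt_succ_sqrt n)
  have ha : a ≤ a * a := by rcases Nat.eq_zero_or_pos a with h | h <;> nlinarith
  have h1 : s n ≤ (a * r + a) * (a * r + a) :=
    calc s n ≤ a * n + a := hs n
      _ = a * (n + 1) := by ring
      _ ≤ a * ((r + 1) * (r + 1)) := Nat.mul_le_mul_left a hn
      _ ≤ a * a * ((r + 1) * (r + 1)) := Nat.mul_le_mul_right _ ha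
      _ = (a * r + a) * (a * r + a) := by ring
  calc Nat.sqrt (s n) ≤ Nat.sqrt ((a * r + a) * (a * r + a)) := Nat.sqrt_le_sqrt h1
    _ = a * r + a := Nat.sqrt_eq _

/-- Pre-composition with a linearly bounded map. [folklore] -/
theorem comp_linear {f : ℕ → ℕ} (hf : IsSqrtExpBounded f) (a : ℕ) {s : ℕ → ℕ}
    (hs : ∀ n, s n ≤ a * n + a) : IsSqrtExpBounded fun n => f (s n) := by
  obtain ⟨c, hc⟩ := hf
  refine ⟨c * a + c, fun n => ?_⟩
  have key := sqrt_le_of_linear hs n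
  calc f (s n) ≤ 2 ^ (c * Nat.sqrt (s n) + c) := hc _
    _ ≤ 2 ^ ((c * a + c) * Nat.sqrt n + (c * a + c)) := by
        refine Nat.pow_le_pow_right Nat.two_pos ?_
        have : c * Nat.sqrt (s n) ≤ c * (a * Nat.sqrt n + a) := Nat.mul_le_mul_left c key
        nlinarith

/-- The arithmetic shape `K · 2^{c ⌊√n⌋} + K` of the time class `FTIME (2^{c√n})` (`K = 2^c`).
[folklore] -/
theorem exists_le_mul_add {f : ℕ → ℕ} (hf : IsSqrtExpBounded f) :
    ∃ c K : ℕ, ∀ n, f n ≤ K * 2 ^ (c * Nat.sqrt n) + K := by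
  obtain ⟨c, hc⟩ := hf
  refine ⟨c, 2 ^ c, fun n => (hc n).trans ?_⟩
  rw [pow_add, mul_comm]
  exact Nat.le_add_right _ _

/-- The shape itself is root-exponentially bounded. [folklore] -/
theorem shape (c K : ℕ) : IsSqrtExpBounded fun n => K * 2 ^ (c * Nat.sqrt n) + K :=
  (((const K).mul (two_pow_mul_sqrt c)).add (const K)).mono fun _ => le_rfl

end IsSqrtExpBounded

/-- The time bound `K · 2^{c ⌊√n⌋} + K` is monotone. [folklore] -/
theorem monotone_sqrtExpLin (c K : ℕ) : Monotone fun n : ℕ => K * 2 ^ (c * Nat.sqrt n) + K := by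
  intro a b hab
  dsimp only
  have := Nat.sqrt_le_sqrt hab
  gcongr
  norm_num

/-! ### `2^{O(√n)}`-time string maps -/

/-- `FEsqrt`: the string functions computable (by a TM2 machine, encoders `id`) within
`K · 2^{c ⌊√n⌋} + K` steps on inputs of length `n` — the time bound of `babaiLuks1983_canonicalForm`
(`∃ c, can ∈ FTIME (2^{c √N})`; the function-class analogue at scale `2^{O(√n)}` of `FE`,
`ExpTimeMaps.lean`). [folklore] -/
def FEsqrt : Set (List Bool → List Bool) :=
  ⋃ c : ℕ, FTIME fun n => 2 ^ (c * Nat.sqrt n)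

/-- Membership in `FEsqrt`, unfolded. [folklore] -/
theorem mem_FEsqrt_iff {g : List Bool → List Bool} :
    g ∈ FEsqrt ↔ ∃ c K : ℕ, TimeComputable (id : List Bool → List Bool) id g
      fun n => K * 2 ^ (c * Nat.sqrt n) + K := by
  simp [FEsqrt, FTIME]

/-- A map computable within a root-exponentially bounded time is in `FEsqrt`. [folklore] -/
theorem mem_FEsqrt_of_isSqrtExpBounded {g : List Bool → List Bool} {t : ℕ → ℕ}
    (hg : TimeComputable (id : List Bool → List Bool) id g t) (ht : IsSqrtExpBounded t) : g ∈ FEsqrt := by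
  obtain ⟨c, K, hK⟩ := ht.exists_le_mul_add
  exact mem_FEsqrt_iff.2 ⟨c, K, hg.mono hK⟩

/-- `FP ⊆ FEsqrt`. [cite: AroraBarakCC2009, §1.3] -/
theorem mem_FEsqrt_of_mem_FP {f : List Bool → List Bool} (hf : f ∈ FP) : f ∈ FEsqrt := by
  obtain ⟨p, hp⟩ := hf
  exact mem_FEsqrt_of_isSqrtExpBounded hp (IsSqrtExpBounded.poly p)

/-- **`FEsqrt` after `FP` with linearly bounded output**: if `f ∈ FP` has `|f w| ≤ a |w| + a` and
`g ∈ FEsqrt` then `g ∘ f ∈ FEsqrt` (`TimeComputable.comp_holds`; `⌊√(a n + a)⌋ ≤ a⌊√n⌋ + a`).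
[cite: AroraBarakCC2009, §1.3 (Claim 1.6)] -/
theorem comp_mem_FEsqrt_of_linear {f g : List Bool → List Bool} (hg : g ∈ FEsqrt) (hf : f ∈ FP) (a : ℕ)
    (hlen : ∀ w, (f w).length ≤ a * w.length + a) : g ∘ f ∈ FEsqrt := by
  obtain ⟨c, K, hK⟩ := mem_FEsqrt_iff.1 hg
  obtain ⟨p, hp⟩ := hf
  obtain ⟨C, hC⟩ := TimeComputable.comp_holds hK hp (monotone_sqrtExpLin c K) (s := fun n => a * n + a)
    (fun w => hlen w)
  refine mem_FEsqrt_of_isSqrtExpBounded hC ?_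
  have h1 : IsSqrtExpBounded fun n => K * 2 ^ (c * Nat.sqrt (a * n + a)) + K :=
    (IsSqrtExpBounded.shape c K).comp_linear a (s := fun n => a * n + a) fun _ => le_rfl
  have h2 : IsSqrtExpBounded fun n => a * n + a :=
    (IsSqrtExpBounded.id.const_mul a).add (IsSqrtExpBounded.const a)
  have h3 := ((((IsSqrtExpBounded.poly p).add h1).add h2).const_mul C).add (IsSqrtExpBounded.const C)
  exact h3.mono fun n => le_rfl

/-- The outputs of an `FEsqrt` map have root-exponential length (boundedly many pushes per step,
`TM2Comp.length_le_of_outputsWithin`). [folklore] -/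
theorem exists_length_le_of_mem_FEsqrt {g : List Bool → List Bool} (hg : g ∈ FEsqrt) :
    ∃ s : ℕ → ℕ, IsSqrtExpBounded s ∧ Monotone s ∧ ∀ w, (g w).length ≤ s w.length := by
  obtain ⟨c, K, M, hM⟩ := mem_FEsqrt_iff.1 hg
  refine ⟨fun n => n + TM2Comp.machinePushBound M.tm * (K * 2 ^ (c * Nat.sqrt n) + K),
    IsSqrtExpBounded.id.add ((IsSqrtExpBounded.shape c K).const_mul _), ?_, fun w => ?_⟩
  · intro a b hab
    dsimp only
    have := monotone_sqrtExpLin c K hab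
    gcongr
  · simpa using TM2Comp.length_le_of_outputsWithin M (hM w)

/-- **`FP` after `FEsqrt`**: if `g ∈ FEsqrt` and `f ∈ FP` then `f ∘ g ∈ FEsqrt` (the intermediate
word has length `2^{O(√n)}`, and a polynomial of that is `2^{O(√n)}`).
[cite: AroraBarakCC2009, §1.3 (Claim 1.6)] -/
theorem comp_mem_FEsqrt {f g : List Bool → List Bool} (hf : f ∈ FP) (hg : g ∈ FEsqrt) :
    f ∘ g ∈ FEsqrt := by
  obtain ⟨s, hs, hsm, hsl⟩ := exists_length_le_of_mem_FEsqrt hg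
  obtain ⟨c, K, hK⟩ := mem_FEsqrt_iff.1 hg
  obtain ⟨p, hp⟩ := hf
  obtain ⟨C, hC⟩ := TimeComputable.comp_holds hp hK (fun a b h => TM2Iter.eval_mono p h) (s := s) hsl
  refine mem_FEsqrt_of_isSqrtExpBounded hC ?_
  have h3 := ((((IsSqrtExpBounded.shape c K).add (hs.poly_comp p)).add hs).const_mul C).add
    (IsSqrtExpBounded.const C)
  exact h3.mono fun n => le_rfl

/-- **`⟨x, y⟩ ↦ ⟨g x, y⟩` at root-exponential scale**: for `g ∈ FEsqrt`, `mapFstFn g ∈ FEsqrt`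
(the machine `mapFstAux` of `MapFstMachine.lean`, `outputsWithin_mapFstAux`: `m + 3|out| + 2|z| + 6`
steps). [cite: AroraBarakCC2009, Thm. 2.8 (proof) and §1.3] -/
theorem mapFstFn_mem_FEsqrt {g : List Bool → List Bool} (hg : g ∈ FEsqrt) : mapFstFn g ∈ FEsqrt := by
  obtain ⟨c, K, M, hM⟩ := mem_FEsqrt_iff.1 hg
  set D := TM2Comp.machinePushBound M.tm
  refine mem_FEsqrt_of_isSqrtExpBounded (t := fun n => (K * 2 ^ (c * Nat.sqrt n) + K) +
      3 * (n + D * (K * 2 ^ (c * Nat.sqrt n) + K)) + 2 * n + 6) ⟨mapFstAux M, fun z => ?_⟩ ?_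
  · have hx := length_boolUnpair_fst_le z
    have hz : M.OutputsWithin (boolUnpair z).1 (g (boolUnpair z).1)
        (K * 2 ^ (c * Nat.sqrt z.length) + K) :=
      (hM (boolUnpair z).1).mono (monotone_sqrtExpLin c K hx)
    have hlen := TM2Comp.length_le_of_outputsWithin M hz
    refine (outputsWithin_mapFstAux M hz).mono ?_
    simp only [id]
    have : (g (boolUnpair z).1).length ≤ z.length + D * (K * 2 ^ (c * Nat.sqrt z.length) + K) := by
      simpa using hlen.trans (Nat.add_le_add_right hx _)
    omega
  · have h3 := ((((IsSqrtExpBounded.shape c K).add ((IsSqrtExpBounded.id.add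
      ((IsSqrtExpBounded.shape c K).const_mul D)).const_mul 3)).add
      (IsSqrtExpBounded.id.const_mul 2)).add (IsSqrtExpBounded.const 6))
    exact h3.mono fun n => le_rfl

/-! ### The root-exponential pad `spad a x = ⟨1^{2^{a⌊√|x|⌋}} 0 1^{a⌊√|x|⌋}, x⟩` -/

/-- `sqrtOnesFn a w = 1^{a ⌊√|w|⌋}`: the brick `onesMulFn a ∘ binToUnaryFn ∘ (w ↦ ⟨w, isqrtFn w⟩)`
(the ruler `w` caps the unary conversion at `|w| ≥ ⌊√|w|⌋`). [folklore] -/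
noncomputable def sqrtOnesFn (a : ℕ) : List Bool → List Bool :=
  Brick.onesMulFn a ∘ binToUnaryFn ∘ fanoutFn (id : List Bool → List Bool) Brick.isqrtFn

/-- **Value of `sqrtOnesFn`.** [folklore] -/
@[simp] theorem sqrtOnesFn_apply (a : ℕ) (w : List Bool) :
    sqrtOnesFn a w = List.replicate (a * Nat.sqrt w.length) true := by
  simp [sqrtOnesFn, Brick.onesMulFn, ones, min_eq_left (Nat.sqrt_le_self _)]

/-- `|sqrtOnesFn a w| = a ⌊√|w|⌋`. [folklore] -/
@[simp] theorem length_sqrtOnesFn (a : ℕ) (w : List Bool) :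
    (sqrtOnesFn a w).length = a * Nat.sqrt w.length := by
  simp

/-- **`sqrtOnesFn a ∈ FP`.** [cite: AroraBarakCC2009, §1.3] -/
theorem sqrtOnesFn_mem_FP (a : ℕ) : sqrtOnesFn a ∈ FP := by
  unfold sqrtOnesFn
  exact comp_mem_FP (Brick.onesMulFn_mem_FP a)
    (comp_mem_FP binToUnaryFn_mem_FP (fanoutFn_mem_FP OracleCompose.id_mem_FP Brick.isqrtFn_mem_FP))

/-- The first component of the pad as a function of the payload:
`padCore a w = expPad 1 (1^{a⌊√|w|⌋}) = 1^{2^{a⌊√|w|⌋}} 0 1^{a⌊√|w|⌋}`. [folklore] -/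
noncomputable def padCore (a : ℕ) : List Bool → List Bool := expPad 1 ∘ sqrtOnesFn a

/-- **Value of `padCore`.** [folklore] -/
theorem padCore_apply (a : ℕ) (w : List Bool) :
    padCore a w = List.replicate (2 ^ (a * Nat.sqrt w.length)) true ++
      false :: List.replicate (a * Nat.sqrt w.length) true := by
  simp [padCore, expPad]

/-- `|padCore a w| = 2^{a⌊√|w|⌋} + a⌊√|w|⌋ + 1`. [folklore] -/
@[simp] theorem length_padCore (a : ℕ) (w : List Bool) :
    (padCore a w).length = 2 ^ (a * Nat.sqrt w.length) + a * Nat.sqrt w.length + 1 := by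
  simp [padCore]

/-- **`padCore a ∈ FEsqrt`**: a polynomial-time brick followed by the exponential pad `expPad 1`
(time `C · 2^m + C` on its input of length `m = a⌊√n⌋`). [cite: AroraBarakCC2009, §1.3 (Claim 1.6)] -/
theorem padCore_mem_FEsqrt (a : ℕ) : padCore a ∈ FEsqrt := by
  obtain ⟨C, hC⟩ := exists_timeComputable_expPad (k := 1) le_rfl
  obtain ⟨p, hp⟩ := sqrtOnesFn_mem_FP a
  have hmono : Monotone fun n : ℕ => C * 2 ^ (n ^ 1) + C := by
    intro x y hxy; dsimp only; gcongr; norm_num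
  obtain ⟨C', hC'⟩ := TimeComputable.comp_holds hC hp hmono (s := fun n => a * Nat.sqrt n)
    (fun w => (length_sqrtOnesFn a w).le)
  refine mem_FEsqrt_of_isSqrtExpBounded hC' ?_
  have h1 : IsSqrtExpBounded fun n => C * 2 ^ ((a * Nat.sqrt n) ^ 1) + C :=
    (IsSqrtExpBounded.shape a C).mono fun n => by simp
  have h2 : IsSqrtExpBounded fun n => a * Nat.sqrt n :=
    (IsSqrtExpBounded.id.const_mul a).mono fun n => Nat.mul_le_mul_left a (Nat.sqrt_le_self n)
  have h3 := ((((IsSqrtExpBounded.poly p).add h1).add h2).const_mul C').add (IsSqrtExpBounded.const C')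
  exact h3.mono fun n => le_rfl

/-- **The root-exponential pad** `spad a x = ⟨1^{2^{a⌊√|x|⌋}} 0 1^{a⌊√|x|⌋}, x⟩`, as the composite
`mapFstFn (padCore a) ∘ copyFn` of library maps: of length at least `2^{a⌊√|x|⌋}`, carrying `x`
verbatim as its second component. [folklore] -/
noncomputable def spad (a : ℕ) : List Bool → List Bool := mapFstFn (padCore a) ∘ copyFn

/-- `spad a x = ⟨padCore a x, x⟩`. [folklore] -/
theorem spad_apply (a : ℕ) (x : List Bool) : spad a x = boolPair (padCore a x) x := by
  simp [spad, Function.comp, copyFn_apply, mapFstFn_boolPair]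

/-- The components of the pad. [folklore] -/
@[simp] theorem boolUnpair_spad (a : ℕ) (x : List Bool) : boolUnpair (spad a x) = (padCore a x, x) := by
  rw [spad_apply, boolUnpair_boolPair]

/-- Length of the pad: `|spad a x| = 2 (2^{a⌊√|x|⌋} + a⌊√|x|⌋ + 1) + 2 + |x|`. [folklore] -/
theorem length_spad (a : ℕ) (x : List Bool) :
    (spad a x).length = 2 * (2 ^ (a * Nat.sqrt x.length) + a * Nat.sqrt x.length + 1) + 2 + x.length := by
  rw [spad_apply, length_boolPair, length_padCore]

/-- `2^{a⌊√|x|⌋} ≤ |spad a x|`. [folklore] -/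
theorem two_pow_le_length_spad (a : ℕ) (x : List Bool) : 2 ^ (a * Nat.sqrt x.length) ≤ (spad a x).length := by
  rw [length_spad]; omega

/-- `|x| ≤ |spad a x|`. [folklore] -/
theorem length_le_length_spad (a : ℕ) (x : List Bool) : x.length ≤ (spad a x).length := by
  rw [length_spad]; omega

/-- The pad is injective (the payload is its second component). [folklore] -/
theorem spad_injective (a : ℕ) : Function.Injective (spad a) := fun x y h => by
  have := congrArg (fun z => (boolUnpair z).2) h
  simpa using this

/-- **The pad is computable in time `2^{O(√n)}`**: `spad a ∈ FEsqrt`. [folklore] -/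
theorem spad_mem_FEsqrt (a : ℕ) : spad a ∈ FEsqrt := by
  refine comp_mem_FEsqrt_of_linear (mapFstFn_mem_FEsqrt (padCore_mem_FEsqrt a)) copyFn_mem_FP 3 fun w => ?_
  rw [copyFn_apply, length_boolPair]; omega

/-- **An `FP` map run on the pad is computable in time `2^{O(√n)}`**: `f ∘ spad a ∈ FEsqrt` for
`f ∈ FP` (the padded word has length `2^{O(√n)}` and a polynomial of that is `2^{O(√n)}`).
[cite: AroraBarakCC2009, §1.3 (Claim 1.6) and §2.6 (padding)] -/
theorem comp_spad_mem_FEsqrt {f : List Bool → List Bool} (hf : f ∈ FP) (a : ℕ) : f ∘ spad a ∈ FEsqrt :=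
  comp_mem_FEsqrt hf (spad_mem_FEsqrt a)

/-! ### The pad on codes of coloured graphs -/

/-- The adjacency code of a graph on `Fin k` has length `k²`. [folklore] -/
@[simp] theorem length_encodingGraphFin_encode (k : ℕ) (G : SimpleGraph (Fin k)) :
    ((encodingGraphFin k).encode G).length = k * k := by
  simp [encodingGraphFin, encodingBitVec]

/-- The code of a coloured graph on `k` vertices has length at least `2 k² + 6 ≥ k²`. [folklore] -/
theorem sq_le_length_colGraphCode (k : ℕ) (G : SimpleGraph (Fin k)) (col : Fin k → ℕ) :
    k * k ≤ (colGraphCode k G col).length := by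
  simp only [colGraphCode, length_boolPair, encodingGraph_encode, length_encodingGraphFin_encode]
  omega

/-- Hence `k ≤ ⌊√N⌋` for the length `N` of the code. [folklore] -/
theorem le_sqrt_length_colGraphCode (k : ℕ) (G : SimpleGraph (Fin k)) (col : Fin k → ℕ) :
    k ≤ Nat.sqrt (colGraphCode k G col).length :=
  Nat.le_sqrt.2 (sq_le_length_colGraphCode k G col)

/-- **The padded code of a coloured graph on `k` vertices has length at least `2^{a k}`** — so a
`C^k · poly(k)`-step computation on it is polynomial in the padded length once `2^a ≥ C`. [folklore] -/
theorem two_pow_mul_le_length_spad_colGraphCode (a k : ℕ) (G : SimpleGraph (Fin k)) (col : Fin k → ℕ) :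
    2 ^ (a * k) ≤ (spad a (colGraphCode k G col)).length :=
  (Nat.pow_le_pow_right Nat.two_pos (Nat.mul_le_mul_left a (le_sqrt_length_colGraphCode k G col))).trans
    (two_pow_le_length_spad a _)

/-! ### The reduction -/

/-- Any canonical form of coloured-graph codes lying in `FEsqrt` proves the named fact
(`babaiLuks1983_canonicalForm` is literally `∃ can ∈ FEsqrt, …`, the union unfolded). [cite: BabaiLuks1983, §4] -/
theorem babaiLuks1983_canonicalForm_of_mem_FEsqrt {can : List Bool → List Bool} (hcan : can ∈ FEsqrt)
    (hform : ∀ (k : ℕ) (G : SimpleGraph (Fin k)) (col : Fin k → ℕ),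
        ∃ (G' : SimpleGraph (Fin k)) (col' : Fin k → ℕ),
          can (colGraphCode k G col) = colGraphCode k G' col' ∧ ColIso k G col G' col')
    (hinv : ∀ (k : ℕ) (G₁ : SimpleGraph (Fin k)) (c₁ : Fin k → ℕ) (G₂ : SimpleGraph (Fin k))
      (c₂ : Fin k → ℕ), ColIso k G₁ c₁ G₂ c₂ → can (colGraphCode k G₁ c₁) = can (colGraphCode k G₂ c₂)) :
    babaiLuks1983_canonicalForm := by
  obtain ⟨c, hc⟩ := Set.mem_iUnion.1 hcan
  exact ⟨c, can, hc, hform, hinv⟩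

/-- **The padding reduction.** If an `FP` map `f`, run on the root-exponentially padded code
`spad a (colGraphCode k G col) = ⟨1^{2^{a⌊√N⌋}} 0 1^{a⌊√N⌋}, colGraphCode k G col⟩` (pad of length
`≥ 2^{a k}`), returns the code of a colour-isomorphic coloured graph and takes equal values on
colour-isomorphic inputs, then `babaiLuks1983_canonicalForm` holds, with `can = f ∘ spad a ∈ FEsqrt`
(`comp_spad_mem_FEsqrt`). This is the interface through which a simply-exponential canoniser
programmed in the `FP` brick algebra discharges the fact. [cite: BabaiLuks1983, §1 and §4; AroraBarakCC2009, §2.6 (padding)] -/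
theorem babaiLuks1983_canonicalForm_of_core (a : ℕ) {f : List Bool → List Bool} (hf : f ∈ FP)
    (hform : ∀ (k : ℕ) (G : SimpleGraph (Fin k)) (col : Fin k → ℕ),
        ∃ (G' : SimpleGraph (Fin k)) (col' : Fin k → ℕ),
          f (spad a (colGraphCode k G col)) = colGraphCode k G' col' ∧ ColIso k G col G' col')
    (hinv : ∀ (k : ℕ) (G₁ : SimpleGraph (Fin k)) (c₁ : Fin k → ℕ) (G₂ : SimpleGraph (Fin k))
      (c₂ : Fin k → ℕ), ColIso k G₁ c₁ G₂ c₂ →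
        f (spad a (colGraphCode k G₁ c₁)) = f (spad a (colGraphCode k G₂ c₂))) :
    babaiLuks1983_canonicalForm :=
  babaiLuks1983_canonicalForm_of_mem_FEsqrt (comp_spad_mem_FEsqrt hf a) hform hinv

/-- **The padding reduction, leader form** — the shape in which a canonical LABELING algorithm
discharges the fact: given a labeling-set function `L` (nonempty-valued, equivariant under
colour-preserving isomorphisms: `L k G₂ c₂ = (L k G₁ c₁).image (·.trans σ)`) and an `FP` map `f`
which, on the padded code `spad a (colGraphCode k G col)` (pad of length `≥ 2^{a k}`), returns the
lexicographic leader of the codes of the relabellings of `(G, col)` along `L k G col`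
(`leaderCode`, `GraphCanonizationLeader.lean`), `babaiLuks1983_canonicalForm` holds — by
`leader_isCanonicalForm` (correctness, machine-free) and `babaiLuks1983_canonicalForm_of_core`
(time `2^{O(√N)}`). For Babai–Luks `L(X) = CL(X)` is the canonical labeling coset; for a search-tree
algorithm `L(X)` is its leaf set, and `|L(X)| · poly ≤ 2^{a k}` is what makes `f` polynomial-time.
[cite: BabaiLuks1983, §1 and §3–4] -/
theorem babaiLuks1983_canonicalForm_of_leader (a : ℕ)
    (L : ∀ k : ℕ, SimpleGraph (Fin k) → (Fin k → ℕ) → Finset (Equiv.Perm (Fin k)))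
    (hne : ∀ (k : ℕ) (G : SimpleGraph (Fin k)) (col : Fin k → ℕ), (L k G col).Nonempty)
    (heqv : ∀ (k : ℕ) (G₁ : SimpleGraph (Fin k)) (c₁ : Fin k → ℕ) (G₂ : SimpleGraph (Fin k))
      (c₂ : Fin k → ℕ) (σ : G₁ ≃g G₂), (∀ v, c₂ (σ v) = c₁ v) →
        L k G₂ c₂ = (L k G₁ c₁).image fun e => e.trans σ.toEquiv)
    {f : List Bool → List Bool} (hf : f ∈ FP)
    (hcomp : ∀ (k : ℕ) (G : SimpleGraph (Fin k)) (col : Fin k → ℕ),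
      f (spad a (colGraphCode k G col)) = leaderCode (L k G col) (hne k G col) G col) :
    babaiLuks1983_canonicalForm := by
  obtain ⟨hform, hinv⟩ := leader_isCanonicalForm L hne heqv
  refine babaiLuks1983_canonicalForm_of_core a hf (fun k G col => ?_) (fun k G₁ c₁ G₂ c₂ hiso => ?_)
  · rw [hcomp]; exact hform k G col
  · rw [hcomp, hcomp]; exact hinv k G₁ c₁ G₂ c₂ hiso

/-- **The padding reduction, search-tree form** — what a canonical-labeling ALGORITHM of the
individualization–refinement type must supply: a family of schemes `S k` (`IRScheme`,
`IndividualizationRefinement.lean`: a label-invariant refinement function and target-cell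
selector, McKay–Piperno 2014, §2.3) and ONE `FP` map `listF` which, on the padded code
`spad a (colGraphCode k G col)` (pad of length `≥ 2^{a k}`), lists the leaf labelings of the
search tree `𝒯(G, col)` as `⟨colGraphCode k G col, encList [permCode e₀, …]⟩` (any order, any
repetitions). Then `babaiLuks1983_canonicalForm` holds: the canonical form is
`leaderOfListFn ∘ listF` (`LeaderFoldBricks.lean`: the lexicographic leader over the listed
relabellings, `leaderOfListFn_apply`), a canonical form by `leader_isCanonicalForm` and
`IRScheme.leafLabelings_isLabelingSet` (McKay–Piperno, Lemmas 1 and 4), in time `2^{O(√N)}` by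
`babaiLuks1983_canonicalForm_of_leader`. The number of leaves only enters through `listF ∈ FP`
(`|leaves| · poly(k) ≤ poly(2^{a k})`, e.g. Corneil–Goldberg's `cⁿ` bound).
[cite: BabaiLuks1983, §1 and §4; MckayPiperno2014, §2.3–2.4 (Lemma 1, Lemma 4)] -/
theorem babaiLuks1983_canonicalForm_of_irScheme (a : ℕ) (S : ∀ k : ℕ, IRScheme k)
    {listF : List Bool → List Bool} (hlist : listF ∈ FP)
    (hspec : ∀ (k : ℕ) (G : SimpleGraph (Fin k)) (col : Fin k → ℕ),
      ∃ Lst : List (Equiv.Perm (Fin k)), (∀ e, e ∈ (S k).leafLabelings G col ↔ e ∈ Lst) ∧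
        listF (spad a (colGraphCode k G col)) =
          boolPair (colGraphCode k G col) (encList (Lst.map GraphRelabel.permCode))) :
    babaiLuks1983_canonicalForm := by
  obtain ⟨hne, heqv⟩ := IRScheme.leafLabelings_isLabelingSet S
  refine babaiLuks1983_canonicalForm_of_leader a (fun k G col => (S k).leafLabelings G col) hne heqv
    (comp_mem_FP LeaderFold.leaderOfListFn_mem_FP hlist) fun k G col => ?_
  obtain ⟨Lst, hLst, hrun⟩ := hspec k G col
  rw [Function.comp_apply, hrun]
  exact LeaderFold.leaderOfListFn_apply G col Lst _ (hne k G col) hLst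

end Literature.Computability.Complexity
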